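import Mathlib

/-!
# Sketch — first lemmas for the crux-idea cards on `NikulinSerreCarrier` (stmt-HodgeConjecture-14464)

Pure linear algebra over Mathlib; nothing here is proved (definitions of `Prop`s only), the point is
that the first checkable statement of each line elaborates.
-/

namespace Summit.HodgeConjecture.HodgeConjecture.Cruxes.NikulinSerreCarrier.Sketch

/-- Card `mckay-fixed-locus-universal-instanton`, first lemma (pointwise core of K-a: the MIXED
curvature term of the tautological universal connection on `X × M` is `SU(2)`-invariant).
Model: `V` = real tangent space of `X` at `x` with three anticommuting complex structures
`I J K` (`I² = J² = K² = −1`, `IJ = K`), `U := V →ₗ[ℝ] F` = tangent space of the moduli space at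
`[A]` (harmonic `End`-valued 1-forms, `F` = fibre of `End E`), with the induced structures
`L_U α := −α ∘ L`.  The mixed term of the universal curvature is `β((v,α),(v',α')) = α' v − α v'`.
CLAIM: `β` is of type `(1,1)` for every induced structure `L = aI + bJ + cK`, `a²+b²+c² = 1`,
i.e. `β(L v ⊕ L_U α, L v' ⊕ L_U α') = β(v ⊕ α, v' ⊕ α')`. -/
def MixedCurvatureInvariant : Prop :=
  ∀ (V F : Type) [AddCommGroup V] [Module ℝ V] [AddCommGroup F] [Module ℝ F]
    (I J K : V →ₗ[ℝ] V),
    I ∘ₗ I = -LinearMap.id → J ∘ₗ J = -LinearMap.id → K ∘ₗ K = -LinearMap.id →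
    I ∘ₗ J = K → J ∘ₗ I = -K →
    ∀ (a b c : ℝ), a ^ 2 + b ^ 2 + c ^ 2 = 1 →
    ∀ (v v' : V) (α α' : V →ₗ[ℝ] F),
      let L : V →ₗ[ℝ] V := a • I + b • J + c • K
      -- induced structure on U = Hom(V,F):  L_U α = -(α ∘ L)
      (-(α' ∘ₗ L)) (L v) - (-(α ∘ₗ L)) (L v') = α' v - α v'

/-- Card `mckay-fixed-locus-universal-instanton`, auxiliary (E3 core, used in `Why it bites`):
a left-`ℍ`-linear map `ℍ → ℍⁿ` (i.e. `v ↦ (v * a i)ᵢ`) is conformal — tri-holomorphic maps out of a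
hyperkähler SURFACE are homotheties pointwise. -/
def QuaternionLinearIsConformal : Prop :=
  ∀ (n : ℕ) (a : Fin n → Quaternion ℝ) (v w : Quaternion ℝ),
    (∑ i, ((v * a i) * star (w * a i)).re) = (∑ i, Quaternion.normSq (a i)) * (v * star w).re

/-- Card `bkr-kernel-lattice-certificate`, first lemma (the partner's Kähler class is DICTATED):
`V'` = `NS(S'')_ℝ` with its (nondegenerate) intersection form `q'`, `V` = `H²(X,ℝ)` with `q`,
`κ : V' → V` the mixed κ₂-class of the carrier read as a correspondence, `h ∈ V` the (ι-invariant)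
Kähler class of `X`.  Verbitsky's invariance needs `κ((ω')^⊥) ⊆ h^⊥`; on `NS` this holds iff
the functional `D ↦ q(κ D, h)` is a multiple of `D ↦ q'(D, ω')`, i.e. `ω'` is proportional to the
`q'`-Riesz representative `κ†h` — so the only candidate Kähler class on the partner is `κ†h`, and the
line dies unless `κ†h` (or `−κ†h`) is ample. -/
def PartnerClassForced : Prop :=
  ∀ (V' : Type) [AddCommGroup V'] [Module ℝ V'] [FiniteDimensional ℝ V']
    (q' : LinearMap.BilinForm ℝ V'),
    q'.Nondegenerate →
    ∀ (φ : V' →ₗ[ℝ] ℝ) (ω' : V'),   -- φ = (D ↦ q(κ D, h)) pulled back to NS(S'')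
      q' ω' ω' ≠ 0 →
      ((∀ D : V', q' D ω' = 0 → φ D = 0) ↔ ∃ c : ℝ, ∀ D : V', φ D = c * q' D ω')

end Summit.HodgeConjecture.HodgeConjecture.Cruxes.NikulinSerreCarrier.Sketch
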